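import Mathlib
import Summits.Ventures.PercRepro2.TypedFibreSurgery

/-!
# Block surgery on a fibre (blind cell PercRepro2, mine-2 g37, 2026-08-28; `proofs/MINE2-FIBRE.md` §1b)

The connectivity lemmas behind the BLOCK-transfer rule (`TypedBlockTransfer.lean`), generalising the
b-surgery of `TypedFibreSurgery.lean` from the single vertex `b` to a vertex block `W`: `closeAtW W ω`
closes every edge touching `W`, `withinW W ω` keeps only the edges inside `W`.  If any two open edges
leaving `W` from the same internal component of `W` have their outer ends joined in a base
configuration `β ≤ closeAtW W ω`, then `W` is redundant for the connectivity of the vertices outside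
it (`conn_iff_closeAtW`), and a vertex of `W` reached from outside is reached through an open edge
leaving `W` and an internal path (`conn_mem_imp`).

Own code; standard axioms.
-/

namespace Summit.Ventures.PercRepro2

open UnionCluster

namespace CovForm

namespace BlockTransfer

section Surgery

open Classical

variable {V : Type*} {E : Type*}
variable (ends : E → Sym2 V) (W : Finset V)

/-- An edge touching the block `W`. -/
def touchesW (e : E) : Prop := ∃ x ∈ W, x ∈ ends e

/-- An edge inside the block `W`. -/
def insideW (e : E) : Prop := ∀ x ∈ ends e, x ∈ W

/-- The configuration with every edge touching `W` closed. -/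
noncomputable def closeAtW (ω : Config E) : Config E :=
  fun e => if touchesW ends W e then false else ω e

/-- The configuration keeping only the open edges inside `W`. -/
noncomputable def withinW (ω : Config E) : Config E :=
  fun e => if insideW ends W e then ω e else false

/-- Every edge has two (possibly equal) ends. -/
lemma exists_ends (e : E) : ∃ x y, ends e = s(x, y) :=
  Sym2.ind (f := fun z => ∃ x y, z = s(x, y)) (fun x y => ⟨x, y, rfl⟩) (ends e)

/-- An edge with an end in `W` touches `W`. -/
lemma touchesW_of_mem {e : E} {x y : V} (h : ends e = s(x, y)) (hx : x ∈ W) : touchesW ends W e :=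
  ⟨x, hx, by rw [h]; exact Sym2.mem_mk_left x y⟩

/-- An edge with both ends outside `W` does not touch `W`. -/
lemma not_touchesW {e : E} {x y : V} (h : ends e = s(x, y)) (hx : x ∉ W) (hy : y ∉ W) :
    ¬ touchesW ends W e := by
  rintro ⟨t, htW, hte⟩
  rw [h, Sym2.mem_iff] at hte
  rcases hte with rfl | rfl
  · exact hx htW
  · exact hy htW

/-- An edge with both ends in `W` is inside `W`. -/
lemma insideW_of_mem {e : E} {x y : V} (h : ends e = s(x, y)) (hx : x ∈ W) (hy : y ∈ W) :
    insideW ends W e := by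
  intro t ht
  rw [h, Sym2.mem_iff] at ht
  rcases ht with rfl | rfl
  · exact hx
  · exact hy

/-- `closeAtW` leaves the edges not touching `W` alone. -/
lemma closeAtW_of_not {ω : Config E} {e : E} (h : ¬ touchesW ends W e) : closeAtW ends W ω e = ω e := by
  simp [closeAtW, h]

/-- `closeAtW` closes the edges touching `W`. -/
lemma closeAtW_of_touch {ω : Config E} {e : E} (h : touchesW ends W e) : closeAtW ends W ω e = false := by
  simp [closeAtW, h]

/-- `withinW` keeps the edges inside `W`. -/
lemma withinW_of_inside {ω : Config E} {e : E} (h : insideW ends W e) : withinW ends W ω e = ω e := by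
  simp [withinW, h]

/-- `closeAtW W ω ≤ ω`. -/
lemma closeAtW_le (ω : Config E) : closeAtW ends W ω ≤ ω := by
  intro e
  by_cases h : touchesW ends W e
  · rw [closeAtW_of_touch ends W h]; exact Bool.false_le _
  · rw [closeAtW_of_not ends W h]

/-- `closeAtW` is monotone. -/
lemma closeAtW_mono {ω ω' : Config E} (h : ω ≤ ω') : closeAtW ends W ω ≤ closeAtW ends W ω' := by
  intro e
  by_cases ht : touchesW ends W e
  · rw [closeAtW_of_touch ends W ht]; exact Bool.false_le _
  · rw [closeAtW_of_not ends W ht, closeAtW_of_not ends W ht]; exact h e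

/-- Configurations agreeing off the edges touching `W` have the same `closeAtW`. -/
lemma closeAtW_eq_of_agree {ω ω' : Config E} (h : ∀ e, ¬ touchesW ends W e → ω e = ω' e) :
    closeAtW ends W ω = closeAtW ends W ω' := by
  funext e
  by_cases ht : touchesW ends W e
  · rw [closeAtW_of_touch ends W ht, closeAtW_of_touch ends W ht]
  · rw [closeAtW_of_not ends W ht, closeAtW_of_not ends W ht, h e ht]

/-- Configurations agreeing on the edges touching `W` have the same `withinW`. -/
lemma withinW_eq_of_agree {ω ω' : Config E} (h : ∀ e, touchesW ends W e → ω e = ω' e) :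
    withinW ends W ω = withinW ends W ω' := by
  funext e
  by_cases hi : insideW ends W e
  · rw [withinW_of_inside ends W hi, withinW_of_inside ends W hi]
    obtain ⟨x, y, hxy⟩ := exists_ends ends e
    have hx : x ∈ W := hi x (by rw [hxy]; exact Sym2.mem_mk_left x y)
    exact h e (touchesW_of_mem ends W hxy hx)
  · simp [withinW, hi]

/-- The attachment hypothesis of a block: any two open edges leaving `W` from the same internal
component have their outer ends joined in the base configuration `β`. -/
def Attached (ω β : Config E) : Prop :=
  ∀ e e', ω e = true → ω e' = true → ∀ x z x' z', ends e = s(x, z) → ends e' = s(x', z') →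
    x ∈ W → z ∉ W → x' ∈ W → z' ∉ W → Conn ends (withinW ends W ω) x x' → Conn ends β z z'

/-- **Block surgery**: under `Attached ω β` with `β ≤ closeAtW W ω`, the block is redundant for the
connectivity of the vertices outside it. -/
lemma conn_iff_closeAtW (ω β : Config E) (hβ : β ≤ closeAtW ends W ω) (H : Attached ends W ω β)
    {u v : V} (hu : u ∉ W) (hv : v ∉ W) :
    Conn ends ω u v ↔ Conn ends (closeAtW ends W ω) u v := by
  constructor
  · intro h
    let T : Set V := {y | (y ∉ W ∧ Conn ends (closeAtW ends W ω) u y) ∨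
      (y ∈ W ∧ ∃ x ∈ W, Conn ends (withinW ends W ω) y x ∧ ∃ e, ω e = true ∧ ∃ z, z ∉ W ∧
        ends e = s(x, z) ∧ Conn ends (closeAtW ends W ω) u z)}
    have hT : ∀ x ∈ T, ∀ y, (openGraph ends ω).Adj x y → y ∈ T := by
      intro x hx y hxy
      rw [openGraph_adj] at hxy
      obtain ⟨-, e, he, hends⟩ := hxy
      by_cases hyW : y ∈ W
      · refine Or.inr ⟨hyW, ?_⟩
        rcases hx with ⟨hxW, hcx⟩ | ⟨hxW, x', hx'W, hcxx', e₁, he₁, z, hzW, hends₁, hcz⟩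
        · exact ⟨y, hyW, conn_refl ends _ y, e, he, x, hxW, by rw [hends, Sym2.eq_swap], hcx⟩
        · have hin : insideW ends W e := insideW_of_mem ends W hends hxW hyW
          have heW : withinW ends W ω e = true := by rw [withinW_of_inside ends W hin]; exact he
          exact ⟨x', hx'W, conn_trans (conn_of_openAdj ⟨e, heW, by rw [hends, Sym2.eq_swap]⟩) hcxx',
            e₁, he₁, z, hzW, hends₁, hcz⟩
      · refine Or.inl ⟨hyW, ?_⟩
        rcases hx with ⟨hxW, hcx⟩ | ⟨hxW, x', hx'W, hcxx', e₁, he₁, z, hzW, hends₁, hcz⟩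
        · have hnt : ¬ touchesW ends W e := not_touchesW ends W hends hxW hyW
          have he₀ : closeAtW ends W ω e = true := by rw [closeAtW_of_not ends W hnt]; exact he
          exact conn_trans hcx (conn_of_openAdj ⟨e, he₀, hends⟩)
        · have hH := H e e₁ he he₁ x y x' z hends hends₁ hxW hyW hx'W hzW hcxx'
          exact conn_trans hcz (conn_symm (conn_mono hβ hH))
    have hmem := mem_of_conn_of_closed hT (Or.inl ⟨hu, conn_refl ends _ u⟩) h
    rcases hmem with ⟨-, hc⟩ | ⟨hvW, -⟩
    · exact hc
    · exact absurd hvW hv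
  · exact conn_mono (closeAtW_le ends W ω)

/-- **Entry lemma**: a vertex of `W` reached from a vertex `r` outside `W` is reached through an open
edge leaving `W` (its outer end joined to `r` off the block) and an internal path. -/
lemma conn_mem_imp (ω β : Config E) (hβ : β ≤ closeAtW ends W ω) (H : Attached ends W ω β)
    {r v : V} (hr : r ∉ W) (hv : v ∈ W) (h : Conn ends ω r v) :
    ∃ x ∈ W, Conn ends (withinW ends W ω) x v ∧ ∃ e, ω e = true ∧ ∃ z, z ∉ W ∧
      ends e = s(x, z) ∧ Conn ends (closeAtW ends W ω) r z := by
  let T : Set V := {y | (y ∉ W ∧ Conn ends (closeAtW ends W ω) r y) ∨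
    (y ∈ W ∧ ∃ x ∈ W, Conn ends (withinW ends W ω) x y ∧ ∃ e, ω e = true ∧ ∃ z, z ∉ W ∧
      ends e = s(x, z) ∧ Conn ends (closeAtW ends W ω) r z)}
  have hT : ∀ x ∈ T, ∀ y, (openGraph ends ω).Adj x y → y ∈ T := by
    intro x hx y hxy
    rw [openGraph_adj] at hxy
    obtain ⟨-, e, he, hends⟩ := hxy
    by_cases hyW : y ∈ W
    · refine Or.inr ⟨hyW, ?_⟩
      rcases hx with ⟨hxW, hcx⟩ | ⟨hxW, x', hx'W, hcx'x, e₁, he₁, z, hzW, hends₁, hcz⟩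
      · exact ⟨y, hyW, conn_refl ends _ y, e, he, x, hxW, by rw [hends, Sym2.eq_swap], hcx⟩
      · have hin : insideW ends W e := insideW_of_mem ends W hends hxW hyW
        have heW : withinW ends W ω e = true := by rw [withinW_of_inside ends W hin]; exact he
        exact ⟨x', hx'W, conn_trans hcx'x (conn_of_openAdj ⟨e, heW, hends⟩), e₁, he₁, z, hzW,
          hends₁, hcz⟩
    · refine Or.inl ⟨hyW, ?_⟩
      rcases hx with ⟨hxW, hcx⟩ | ⟨hxW, x', hx'W, hcx'x, e₁, he₁, z, hzW, hends₁, hcz⟩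
      · have hnt : ¬ touchesW ends W e := not_touchesW ends W hends hxW hyW
        have he₀ : closeAtW ends W ω e = true := by rw [closeAtW_of_not ends W hnt]; exact he
        exact conn_trans hcx (conn_of_openAdj ⟨e, he₀, hends⟩)
      · have hH := H e e₁ he he₁ x y x' z hends hends₁ hxW hyW hx'W hzW (conn_symm hcx'x)
        exact conn_trans hcz (conn_symm (conn_mono hβ hH))
  have hmem := mem_of_conn_of_closed hT (Or.inl ⟨hr, conn_refl ends _ r⟩) h
  rcases hmem with ⟨hvW, -⟩ | ⟨-, hex⟩
  · exact absurd hv hvW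
  · exact hex

/-- The converse of the entry lemma: an open edge leaving `W` whose outer end is joined to `r` off
the block, followed by an internal path, joins `r` to the vertex of `W`. -/
lemma conn_of_entry (ω : Config E) {r v x z : V} {e : E} (he : ω e = true) (hends : ends e = s(x, z))
    (hxv : Conn ends (withinW ends W ω) x v) (hrz : Conn ends (closeAtW ends W ω) r z) :
    Conn ends ω r v :=
  conn_trans (conn_mono (closeAtW_le ends W ω) hrz)
    (conn_trans (conn_symm (conn_of_openAdj ⟨e, he, hends⟩)) (conn_mono (by
      intro e'; unfold withinW; split_ifs <;> simp) hxv))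

end Surgery

end BlockTransfer

end CovForm

end Summit.Ventures.PercRepro2
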